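import Summits.PneNP.PneNP.Theorems.KarlinRubinMonotoneBlindFormDefs

/-!
# Route KarlinRubin, crux `MonotoneBlind` (stmt-PneNP-18027): the switched DNF has few terms

Stage C of the AC⁰ line (seat write-up `MonotoneBlind_AC0_announce.md`). The explicit switched DNF `swDnf V₁ x l`
(`KarlinRubinMonotoneBlindFormDefs.lean`) collects the black queried slots of the accepted inside assignments of the
canonical run. If every accepted run queries `≤ R` slots, it has at most `2^R` terms (not merely `(#slots+1)^R`): the
canonical run is a decision tree whose stages branch over the black subsets of the newly queried slots, and along every
accepted path the block sizes sum to `≤ R` (`card_image_blacks_le`, by induction on the clause list from an arbitrary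
state; `card_swDnf_le_two_pow`). This keeps the fan-ins polynomial with a FIXED exponent along the depth reduction.

All `--supports stmt-PneNP-18027`; no definitions.
-/

set_option linter.dupNamespace false -- `Summit.PneNP.PneNP.…`: summit = sub-problem (D-0017)

namespace Summit.PneNP.PneNP.Theorems

open Finset
open Literature.Computability.Complexity
open Literature.Probability.RandomGraphs.PlantedClique

variable {n : ℕ}

open Classical in
/-- **Accepted runs from a state have few black-sets.** From the queried set `K` with recorded blacks `B₀ ⊆ K`: if
every inside assignment consistent with `(K, B₀)` (on `K`, black exactly on `B₀`) and accepted queries `≤ R` slots in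
total, then the black queried sets of these assignments take at most `2^{R - #K}` values. [cite: Beame1994, §3] -/
theorem card_image_blacks_le (V : Finset (Fin n)) (x : EdgeVec n) (R : ℕ) :
    ∀ (l : List (Finset (⊤ : SimpleGraph (Fin n)).edgeSet)) (K B₀ : Finset (⊤ : SimpleGraph (Fin n)).edgeSet),
      B₀ ⊆ K →
      (∀ z : EdgeVec n, (∀ e ∈ K, z e = true ↔ e ∈ B₀) → (swRun V x z l K).1 = true → #(swRun V x z l K).2 ≤ R) →
      #((univ.filter fun z : EdgeVec n => (∀ e ∈ K, z e = true ↔ e ∈ B₀) ∧ (swRun V x z l K).1 = true).image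
          fun z => (swRun V x z l K).2.filter fun e => z e = true) ≤ 2 ^ (R - #K) := by
  intro l
  induction l with
  | nil =>
    intro K B₀ hB₀ _
    -- no more queries: the black set is `B₀`
    refine le_trans (card_le_one.2 fun T hT T' hT' => ?_) Nat.one_le_two_pow
    simp only [swRun_nil, mem_image, mem_filter, mem_univ, true_and] at hT hT'
    obtain ⟨z, ⟨hz, -⟩, rfl⟩ := hT
    obtain ⟨z', ⟨hz', -⟩, rfl⟩ := hT'
    ext e
    simp only [mem_filter]
    constructor
    · rintro ⟨he, hze⟩; exact ⟨he, (hz' e he).2 ((hz e he).1 hze)⟩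
    · rintro ⟨he, hze⟩; exact ⟨he, (hz e he).2 ((hz' e he).1 hze)⟩
  | cons S l ih =>
    intro K B₀ hB₀ hR
    by_cases h1 : ∃ e ∈ S, (¬ ∀ v ∈ (e : Sym2 (Fin n)), v ∈ V) ∧ x e = true
    · -- skipped clause (black outside slot)
      have hrun : ∀ z, swRun V x z (S :: l) K = swRun V x z l K := fun z => by rw [swRun_cons, if_pos h1]
      simp only [hrun] at hR ⊢
      exact ih K B₀ hB₀ hR
    by_cases h2 : ∃ e ∈ S, (∀ v ∈ (e : Sym2 (Fin n)), v ∈ V) ∧ e ∈ B₀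
    · -- skipped clause (recorded black inside slot)
      have hrun : ∀ z : EdgeVec n, (∀ e ∈ K, z e = true ↔ e ∈ B₀) → swRun V x z (S :: l) K = swRun V x z l K := by
        intro z hz
        obtain ⟨e, he, he1, heB⟩ := h2
        rw [swRun_cons, if_neg h1, if_pos ⟨e, he, he1, hB₀ heB, (hz e (hB₀ heB)).2 heB⟩]
      have hR' : ∀ z : EdgeVec n, (∀ e ∈ K, z e = true ↔ e ∈ B₀) → (swRun V x z l K).1 = true →
          #(swRun V x z l K).2 ≤ R := fun z hz hacc => by
        have h := hR z hz (by rw [hrun z hz]; exact hacc)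
        rwa [hrun z hz] at h
      refine le_trans (card_le_card fun T hT => ?_) (ih K B₀ hB₀ hR')
      simp only [mem_image, mem_filter, mem_univ, true_and] at hT ⊢
      obtain ⟨z, ⟨hz, hacc⟩, rfl⟩ := hT
      exact ⟨z, ⟨hz, by rw [← hrun z hz]; exact hacc⟩, by rw [hrun z hz]⟩
    -- a stage: branch over the black subset `a` of the new slots `hS \ K`
    set hS := S.filter (fun e : (⊤ : SimpleGraph (Fin n)).edgeSet => ∀ v ∈ (e : Sym2 (Fin n)), v ∈ V) with hhS
    set K' := K ∪ hS with hK'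
    have hstage : ∀ z : EdgeVec n, (∀ e ∈ K, z e = true ↔ e ∈ B₀) →
        swRun V x z (S :: l) K =
          if ∀ e ∈ S, (∀ v ∈ (e : Sym2 (Fin n)), v ∈ V) → z e = false then (false, K') else swRun V x z l K' := by
      intro z hz
      have h2' : ¬ ∃ e ∈ S, (∀ v ∈ (e : Sym2 (Fin n)), v ∈ V) ∧ e ∈ K ∧ z e = true := by
        rintro ⟨e, he, he1, heK, hze⟩
        exact h2 ⟨e, he, he1, (hz e heK).1 hze⟩
      rw [swRun_cons, if_neg h1, if_neg h2']
    -- consistency with `(K', B₀ ∪ a)` for a nonempty `a` lifts to `(K, B₀)` with the run continuing from `K'`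
    have hlift : ∀ a : Finset (⊤ : SimpleGraph (Fin n)).edgeSet, a ⊆ hS \ K → a.Nonempty →
        ∀ z : EdgeVec n, (∀ e ∈ K', z e = true ↔ e ∈ B₀ ∪ a) →
          (∀ e ∈ K, z e = true ↔ e ∈ B₀) ∧ swRun V x z (S :: l) K = swRun V x z l K' := by
      intro a ha hane z hz
      have hzK : ∀ e ∈ K, z e = true ↔ e ∈ B₀ := by
        intro e he
        rw [hz e (mem_union_left _ he), mem_union]
        exact ⟨fun h => h.elim id fun h => absurd he (mem_sdiff.1 (ha h)).2, Or.inl⟩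
      refine ⟨hzK, ?_⟩
      rw [hstage z hzK, if_neg]
      intro hall
      obtain ⟨e, hea⟩ := hane
      have he' := ha hea
      rw [mem_sdiff, hhS, mem_filter] at he'
      have hze : z e = true :=
        (hz e (mem_union_right _ (by rw [hhS, mem_filter]; exact he'.1))).2 (mem_union_right _ hea)
      rw [hall e he'.1.1 he'.1.2] at hze
      exact Bool.false_ne_true hze
    -- the induction hypothesis in every branch
    have hbranch : ∀ a ∈ (hS \ K).powerset.filter (fun a => a.Nonempty),
        #(((univ.filter fun z : EdgeVec n =>
          (∀ e ∈ K', z e = true ↔ e ∈ B₀ ∪ a) ∧ (swRun V x z l K').1 = true).image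
            fun z => (swRun V x z l K').2.filter fun e => z e = true)) ≤ 2 ^ (R - #K') := by
      intro a ha
      rw [mem_filter, mem_powerset] at ha
      refine ih K' (B₀ ∪ a) (union_subset (hB₀.trans subset_union_left)
        (ha.1.trans (sdiff_subset.trans subset_union_right))) fun z hz hacc => ?_
      obtain ⟨hzK, hrun⟩ := hlift a ha.1 ha.2 z hz
      have h := hR z hzK (by rw [hrun]; exact hacc)
      rwa [hrun] at h
    -- cover of the accepted consistent assignments by the branches
    have hcover : ((univ.filter fun z : EdgeVec n => (∀ e ∈ K, z e = true ↔ e ∈ B₀) ∧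
          (swRun V x z (S :: l) K).1 = true).image fun z => (swRun V x z (S :: l) K).2.filter fun e => z e = true) ⊆
        ((hS \ K).powerset.filter fun a => a.Nonempty).biUnion fun a => ((univ.filter fun z : EdgeVec n =>
          (∀ e ∈ K', z e = true ↔ e ∈ B₀ ∪ a) ∧ (swRun V x z l K').1 = true).image
            fun z => (swRun V x z l K').2.filter fun e => z e = true) := by
      intro T hT
      simp only [mem_image, mem_filter, mem_univ, true_and] at hT
      obtain ⟨z, ⟨hz, hacc⟩, rfl⟩ := hT
      have hst := hstage z hz
      have hnot : ¬ ∀ e ∈ S, (∀ v ∈ (e : Sym2 (Fin n)), v ∈ V) → z e = false := by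
        intro hall; rw [hst, if_pos hall] at hacc; exact Bool.false_ne_true hacc
      rw [hst, if_neg hnot] at hacc ⊢
      -- the black new slots
      set a := ((hS \ K).filter fun e => z e = true) with ha
      have hane : a.Nonempty := by
        by_contra hemp
        rw [not_nonempty_iff_eq_empty] at hemp
        refine hnot fun e he he1 => ?_
        cases hze : z e
        · rfl
        · exfalso
          by_cases heK : e ∈ K
          · exact h2 ⟨e, he, he1, (hz e heK).1 hze⟩
          · have : e ∈ a := by
              rw [ha, mem_filter, mem_sdiff, hhS, mem_filter]
              exact ⟨⟨⟨he, he1⟩, heK⟩, hze⟩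
            rw [hemp] at this
            exact notMem_empty e this
      rw [mem_biUnion]
      refine ⟨a, mem_filter.2 ⟨mem_powerset.2 (filter_subset _ _), hane⟩, ?_⟩
      simp only [mem_image, mem_filter, mem_univ, true_and]
      refine ⟨z, ⟨fun e he => ?_, hacc⟩, rfl⟩
      rw [hK', mem_union] at he
      rw [mem_union, ha, mem_filter, mem_sdiff]
      by_cases heK : e ∈ K
      · rw [hz e heK]
        exact ⟨fun h => Or.inl h, fun h => h.elim id fun h => absurd heK h.1.2⟩
      · have heS : e ∈ hS := he.resolve_left heK
        exact ⟨fun h => Or.inr ⟨⟨heS, heK⟩, h⟩, fun h => h.elim (fun h => absurd (hB₀ h) heK) fun h => h.2⟩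
    refine (card_le_card hcover).trans (card_biUnion_le.trans ?_)
    by_cases hKR : #K' ≤ R
    · calc ∑ a ∈ (hS \ K).powerset.filter (fun a => a.Nonempty), #(((univ.filter fun z : EdgeVec n =>
            (∀ e ∈ K', z e = true ↔ e ∈ B₀ ∪ a) ∧ (swRun V x z l K').1 = true).image
              fun z => (swRun V x z l K').2.filter fun e => z e = true))
          ≤ ∑ _a ∈ (hS \ K).powerset.filter (fun a => a.Nonempty), 2 ^ (R - #K') := sum_le_sum hbranch
        _ ≤ ∑ _a ∈ (hS \ K).powerset, 2 ^ (R - #K') := sum_le_sum_of_subset (filter_subset _ _)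
        _ = 2 ^ #(hS \ K) * 2 ^ (R - #K') := by rw [sum_const, card_powerset, smul_eq_mul]
        _ ≤ 2 ^ (R - #K) := by
            rw [← pow_add]
            refine Nat.pow_le_pow_right two_pos ?_
            have hcard : #K' = #K + #(hS \ K) := by
              rw [hK', ← union_sdiff_self_eq_union, card_union_of_disjoint disjoint_sdiff]
            omega
    · -- no branch has an accepted consistent assignment: it would query `≥ #K' > R` slots
      refine le_trans (le_of_eq (sum_eq_zero fun a ha => card_eq_zero.2 ?_)) (Nat.zero_le _)
      rw [image_eq_empty, filter_eq_empty_iff]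
      rintro z - ⟨hz, hacc⟩
      rw [mem_filter, mem_powerset] at ha
      obtain ⟨hzK, hrun⟩ := hlift a ha.1 ha.2 z hz
      have h := hR z hzK (by rw [hrun]; exact hacc)
      rw [hrun] at h
      exact hKR ((card_le_card (subset_swRun_snd V x z l K')).trans h)

open Classical in
/-- **The switched DNF has at most `2^R` terms** when every accepted canonical run queries `≤ R` slots.
[cite: Beame1994, §3] -/
theorem card_swDnf_le_two_pow (V₁ : Finset (Fin n)) (x : EdgeVec n)
    (l : List (Finset (⊤ : SimpleGraph (Fin n)).edgeSet)) (R : ℕ)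
    (hR : ∀ z : EdgeVec n, (swRun V₁ x z l ∅).1 = true → #(swRun V₁ x z l ∅).2 ≤ R) :
    #(swDnf V₁ x l) ≤ 2 ^ R := by
  have h := card_image_blacks_le V₁ x R l ∅ ∅ (empty_subset _) fun z _ hacc => hR z hacc
  rw [card_empty, Nat.sub_zero] at h
  refine le_trans (le_of_eq ?_) h
  rw [swDnf]
  congr 1
  ext T
  simp only [mem_image, mem_filter, mem_univ, true_and, notMem_empty, iff_false, IsEmpty.forall_iff,
    implies_true]

/-- **On the good event the switched DNF has `≤ 2^r` terms**, `r = C(v₀-1,2)`. [cite: Beame1994, §3] -/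
theorem card_swDnf_le_of_good (V₁ : Finset (Fin n)) (x : EdgeVec n)
    (l : List (Finset (⊤ : SimpleGraph (Fin n)).edgeSet)) (v₀ : ℕ)
    (hgood : ∀ z : EdgeVec n, #(univ.filter fun v : Fin n =>
      ∃ e ∈ (swRun V₁ x z l ∅).2, v ∈ (e : Sym2 (Fin n))) < v₀) :
    #(swDnf V₁ x l) ≤ 2 ^ (v₀ - 1).choose 2 := by
  classical
  refine card_swDnf_le_two_pow V₁ x l _ fun z _ => ?_
  refine (swDnf_bnd_of_good.card_le_choose_two_of_inside' (univ.filter fun v : Fin n =>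
    ∃ e ∈ (swRun V₁ x z l ∅).2, v ∈ (e : Sym2 (Fin n))) _ fun e he v hv =>
      mem_filter.2 ⟨mem_univ _, e, he, hv⟩).trans (Nat.choose_le_choose 2 ?_)
  have := hgood z
  omega

/-- The arithmetic of the branching count: `2^b · 2^{R-(a+b)} ≤ 2^{R-a}` when `a + b ≤ R`. [folklore] -/
theorem two_pow_mul_two_pow_sub_le (a b R : ℕ) (h : a + b ≤ R) : 2 ^ b * 2 ^ (R - (a + b)) ≤ 2 ^ (R - a) := by
  rw [← pow_add]
  exact Nat.pow_le_pow_right two_pos (by omega)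

/-- Registered stub `stub_switchSmall` of the AC⁰ line, stage C (the branching arithmetic of `card_image_blacks_le`).
[folklore] -/
theorem stub_switchSmall : ∀ a b R : ℕ, a + b ≤ R → 2 ^ b * 2 ^ (R - (a + b)) ≤ 2 ^ (R - a) :=
  fun a b R h => two_pow_mul_two_pow_sub_le a b R h

end Summit.PneNP.PneNP.Theorems
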